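import Summits.BirchSwinnertonDyer.BirchSwinnertonDyer.Theorems.ClassRecordThreeShimuraKolyvaginOrderBoundAtThreeSurjOrderShiftAtPrime
import Summits.BirchSwinnertonDyer.BirchSwinnertonDyer.Theorems.ErratumRoadFiveShimuraKolyvaginOrderBoundInertShiftMachine
import Summits.BirchSwinnertonDyer.BirchSwinnertonDyer.Theorems.ClassRecordThreeShimuraKolyvaginOrderBoundAtThreeSurjOrderLeaves
import Literature.NumberTheory.EllipticCurves.HeegnerPointsKolyvaginPrimaryPointsProofs
import HarnessLib

/-!
# Kolyvagin's ORDER bound, conductor-keyed, run at DEPTH `M + k` — part 8′ (ENTRY): the bound at ONE odd surjective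
# prime from Heegner-type POINTS `hpoints` asked only at Kolyvagin primes of depth `M + k`, Kolyvagin reciprocity
# `hRT` (standard depth) and the Cassels–Tate inputs — for ANY Euler system at the conductor level

Cell `bsd-stepL` (run/shared/lean/pub/bsd-stepL/), seat `bsd-stepL-shim3a` (prover g2), HELPER for the crux
`Summit.BirchSwinnertonDyer.BirchSwinnertonDyer.Theses.ClassRecordThree.ShimuraKolyvaginOrderBoundAtThreeSurj`
(item stmt-BirchSwinnertonDyer-19899; `--supports … --as helper`); serves S2 `stub_inert_divisibleIndex` of item
19718 and item 19627 verbatim (it is `p`-generic). Road memo HOME/shim/SHIM3A-G2-ROAD-19899.md §2 (ε₃). Sequel of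
parts 1–7.

## What

Step (iii) of the ORDER-form level shift (road memo §2 (γ₃′)): `…_shift` = the conductor-keyed ENTRY (p482362) with the
`hpoints` clauses asked only at square-free products of Kolyvagin primes of depth `M + k` (classes via shim-p1's
`exists_leafA_of_points_shift`, p481479; leaves (B) ∕ (B₂) at deep primes from the standard-depth reciprocity `hRT`
through `frobEqFrobInfty_pow_of_le`, p480963). Original: conductor-keyed twin of x11b3's CORE entry `KolyvaginOrder.card_sha_primary_le_at_of_pointsM_of_reciprocityFinset_of_localDuality`
(`X11b/KolyvaginShaOrderOfPoints.lean`): for ONE odd prime `p` with `ρ̄_{E,p}` onto, `K` imaginary quadratic,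
`E = W/ℚ` of conductor `N₀`, a point `P ∈ E(K)` of infinite order with `p^{M₀} x₀ = P ∉ p^{M₀+1} E(K)`, `M₀ ≥ 1`:
`Ш(E/K)[p^∞]` finite, `p^{M₀} Ш(E/K)[p^∞] = 0`, `#Ш(E/K)[p^∞] ≤ p^{2M₀}`, `ord_p #Ш(E/K)[p^∞] ≤ 2M₀` — GRANTED the
ABSTRACT Heegner-type data `hpoints` (per level `M`: admissible modules `A m`, points `Pt m ∈ invPoints (A m) p^M`
with `Pt 1 = P`, eigen ∕ Selmer-off-`m` ∕ McCallum-4.4 clauses — the output of Kolyvagin's derivative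
construction on ANY Euler system of Heegner type, McCallum §4), Kolyvagin reciprocity in pairing form `hRT`, and
the displayed Cassels–Tate inputs at level `p^{M₀}`. Statement = the tree's with `(hP : IsHeegnerPoint N₀ W K P)`
replaced by `(hN : W.conductorNorm ℤ = N₀)`; proof = the tree's (Čebotarev and Weil-pairing facts DISCHARGED by
`chebotarev_artinRep_holds` ∕ `exists_weilPairing_holds` exactly as there). THIS is the entry a Shimura-curve
Euler system (`X_{N⁺,N⁻}`, crux 19899 at `p = 3`, cruxes 19718 ∕ 19627 at `p ≥ 5`) can feed: the Heegner-point
binder that made the tree's entry unusable off `X₀(N)` (no Heegner point of level `N` over `K` when a prime of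
`N` is inert) is gone.

## Honest framing

THEOREMS ONLY (no `def`, no named fact, no `sorry`; axioms standard). Nothing here constructs an Euler system
(`hpoints` ∕ `hRT` stay hypotheses) or discharges a Cassels–Tate input; item 19899 stays OPEN. BSD is not proved
by any of this.

## References

[cite: McCallumLMS1991, §1 Theorem (Kolyvagin), Lemma 5.1, §2 Prop. 2.2, §5 Thm. 5.4, Cor. 5.6]
[cite: GrossLMS1991, §2 Thm. 2.2 (2), §§3–8, §10] [cite: MilneADT2006, Ch. I §6, Prop. 6.9, Thm. 6.13(a)]
presearch: not applicable (re-keying of tree theorems). Tree: `lean search 'reciprocityFinset_of_localDuality_shift'` → none.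
-/

noncomputable section

open scoped Classical Pointwise
set_option linter.dupNamespace false
namespace Summit.BirchSwinnertonDyer.BirchSwinnertonDyer.Theorems.ShimuraKolyvaginOrder

open WeierstrassCurve NumberField IsDedekindDomain Field Function
open Literature.NumberTheory.EllipticCurves Literature.NumberTheory.EllipticCurves.KolyvaginDescent
open Literature.NumberTheory.GaloisRepresentations
open Literature.NumberTheory.GaloisCohomology
open Literature.NumberTheory.GaloisRepresentations.DiscreteGaloisModule (mu MuCarrier)
open Summit.BirchSwinnertonDyer.Rank1Residual.X11b
open Summit.BirchSwinnertonDyer.BirchSwinnertonDyer.Theorems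
open Summit.BirchSwinnertonDyer.BirchSwinnertonDyer.Theorems.ShimuraKolyvaginLocalShift (frobEqFrobInfty_pow_of_le)

-- Cup products need `LocallyCompactSpace Γ_K`; as in the tree's Cassels–Tate files.
attribute [local instance] absoluteGaloisGroup_compactSpace

-- `CharZero` of the completions (the Cassels–Tate local terms), as in the tree's files.
attribute [local instance] charZero_placeCompletion

variable (W : WeierstrassCurve ℚ) {K : Type} [Field K] [NumberField K]

/-- **Kolyvagin's bound on `Ш(E/K)[p^∞]` at one odd prime `p` with `ρ̄_{E,p}` onto, order form, from
Heegner-type points and Kolyvagin reciprocity (pairing form) at `p` and the Cassels–Tate inputs at level `p^{M₀}`,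
conductor-keyed, `hpoints` at depth `M + k`** — twin of x11b3's `KolyvaginOrder.card_sha_primary_le_at_of_pointsM_of_reciprocityFinset_of_localDuality`
(McCallum 1991 §1 Theorem (Kolyvagin) ∕ Cor. 5.6; Gross 1991 Thm. 2.2 (2); module docstring), the Heegner-point
binder replaced by `hN : W.conductorNorm ℤ = N₀`. [cite: McCallumLMS1991, §1 Theorem (Kolyvagin), Lemma 5.1, §2 Prop. 2.2,
Thm. 5.4, Cor. 5.6] [cite: GrossLMS1991, §2 Thm. 2.2 (2), §§3–8, §10] [cite: MilneADT2006, Ch. I §6, Prop. 6.9, Thm. 6.13(a)] -/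
theorem card_sha_primary_le_at_of_pointsM_of_reciprocityFinset_of_localDuality_shift
    [W.IsElliptic] (hK : IsImaginaryQuadratic K) {N₀ : ℕ} [NeZero N₀] (hN : W.conductorNorm ℤ = N₀) (k : ℕ)
    {P : (W.baseChange K).toAffine.Point} (hnt : ¬ IsOfFinAddOrder P) {p : ℕ} (hp : p.Prime) (hp2 : p ≠ 2)
    (hρ : W.HasSurjectiveModNGaloisRep p) {M₀ : ℕ} (hM₀ : 1 ≤ M₀) [NeZero (p ^ M₀)]
    {c : K ≃ₐ[ℚ] K} (hc : c ≠ 1) (hcc : c * c = 1)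
    {x₀ : (W.baseChange K).toAffine.Point} (hx₀ : p ^ M₀ • x₀ = P)
    (hmax : ∀ Q : (W.baseChange K).toAffine.Point, p ^ (M₀ + 1) • Q ≠ P)
    (hpoints : ∀ {M : ℕ} (_hM : 1 ≤ M)
      (hdiv : ∀ Q : geomPoints (W.baseChange K), ∃ R, ((p ^ M : ℕ) : ℤ) • R = Q)
      (c : K ≃ₐ[ℚ] K) (_hc : c ≠ 1),
      ∃ (ε : ℤ) (τ : AlgebraicClosure K ≃+* AlgebraicClosure K) (hτ : IsLiftOfAut c τ)
        (A : ℕ → AddSubgroup (geomPoints (W.baseChange K)))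
        (hA : ∀ m, KolyvaginCocycle.IsAdmissible (Field.absoluteGaloisGroup K) (A m)
          ((p ^ M : ℕ) : ℤ))
        (Pt : ℕ → geomPoints (W.baseChange K))
        (hPt : ∀ m, Pt m ∈
          KolyvaginCocycle.invPoints (Field.absoluteGaloisGroup K) (A m) ((p ^ M : ℕ) : ℤ)),
        (ε = 1 ∨ ε = -1) ∧
        IsOfFinAddOrder (Affine.Point.map (W' := W) (c : K →ₐ[ℚ] K) P - ε • P) ∧
        (∀ m, ∀ a ∈ A m, hτ.pointsMap W a ∈ A m) ∧
        Pt 1 = toGeomPoints (W.baseChange K) P ∧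
        (∀ m : ℕ, Squarefree m →
          (∀ q ∈ m.primeFactors, IsKolyvaginPrime N₀ W K p q ∧ FrobEqFrobInfty W K (p ^ (M + k)) q) →
          (∃ B ∈ A m, hτ.pointsMap W (Pt m) =
            (ε * (-1) ^ m.primeFactors.card) • Pt m + ((p ^ M : ℕ) : ℤ) • B) ∧
          (∀ v : HeightOneSpectrum (𝓞 K), (m : 𝓞 K) ∉ v.asIdeal →
            kolyvaginClass (W.baseChange K) _ hdiv (hA m) (Pt m) (hPt m) ∈
              selmerLocalKer (W.baseChange K) (v.adicCompletion K) ((p ^ M : ℕ) : ℤ)) ∧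
          (∀ ℓ : ℕ, ℓ.Prime → ℓ ∣ m → ∀ v : HeightOneSpectrum (𝓞 K), (ℓ : 𝓞 K) ∈ v.asIdeal →
            ∀ a : ℕ, (((p : ℤ) ^ a) •
                kolyvaginClass (W.baseChange K) _ hdiv (hA m) (Pt m) (hPt m) ∈
                selmerLocalKer (W.baseChange K) (v.adicCompletion K) ((p ^ M : ℕ) : ℤ) ↔
              ((p : ℤ) ^ a) • kolyvaginClass (W.baseChange K) _ hdiv (hA (m / ℓ)) (Pt (m / ℓ))
                  (hPt (m / ℓ)) ∈
                (W.baseChange K).torsionLocalKer (v.adicCompletion K) ((p ^ M : ℕ) : ℤ)))))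
    (hRT : ∀ {M : ℕ} (_hM : 1 ≤ M) {ℓ : ℕ} (hℓ : IsKolyvaginPrime N₀ W K p ℓ),
      FrobEqFrobInfty W K (p ^ M) ℓ →
      ∃ (A : Type) (_ : AddCommGroup A)
        (e : geomTorsion (W.baseChange K) ((p ^ M : ℕ) : ℤ) →+
          geomTorsion (W.baseChange K) ((p ^ M : ℕ) : ℤ) →+ A),
        (∀ x, e x x = 0) ∧ (∀ x, (∀ y, e x y = 0) → x = 0) ∧
        ∀ (T : Finset (HeightOneSpectrum (𝓞 K))),
        ∀ s ∈ selmerGroup (W.baseChange K) ((p ^ M : ℕ) : ℤ),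
          (∀ v ∈ T, s ∈ (W.baseChange K).torsionLocalKer (v.adicCompletion K) ((p ^ M : ℕ) : ℤ)) →
          ∀ c' : galH1Torsion (W.baseChange K) ((p ^ M : ℕ) : ℤ),
          (∀ v : HeightOneSpectrum (𝓞 K), v ∉ T → (ℓ : 𝓞 K) ∉ v.asIdeal →
            c' ∈ selmerLocalKer (W.baseChange K) (v.adicCompletion K) ((p ^ M : ℕ) : ℤ)) →
          (∀ w : InfinitePlace K,
            c' ∈ selmerLocalKer (W.baseChange K) w.Completion ((p ^ M : ℕ) : ℤ)) →
          ∀ 𝔔 ∈ hℓ.place.primesAbove, ∀ F : Field.absoluteGaloisGroup K,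
            IsArithFrobAt (𝓞 K) F 𝔔 →
            F ∈ torsionFixing (W.baseChange K) ((p ^ M : ℕ) : ℤ) →
            ∀ σ ∈ 𝔔.inertia (Field.absoluteGaloisGroup K),
            e (h1Eval (W.baseChange K) ((p ^ M : ℕ) : ℤ) s F)
              (h1Eval (W.baseChange K) ((p ^ M : ℕ) : ℤ) c' σ) = 0)
    (e : geomTorsion (W.baseChange K) ((p ^ M₀ * p ^ M₀ : ℕ) : ℤ) →
      geomTorsion (W.baseChange K) ((p ^ M₀ * p ^ M₀ : ℕ) : ℤ) → AlgebraicClosure K)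
    (hμ : ∀ S T, e S T ^ (p ^ M₀ * p ^ M₀) = 1)
    (hadd₁ : ∀ S₁ S₂ T, e (S₁ + S₂) T = e S₁ T * e S₂ T)
    (hadd₂ : ∀ S T₁ T₂, e S (T₁ + T₂) = e S T₁ * e S T₂)
    (hgal : ∀ (σ : absoluteGaloisGroup K) (S T : geomTorsion (W.baseChange K) ((p ^ M₀ * p ^ M₀ : ℕ) : ℤ)),
      σ • e S T = e (σ • S) (σ • T))
    (halt : ∀ T, e T T = 1) (hnondeg : ∀ T, (∀ S, e S T = 1) → T = 0)
    (inv : LocalInvariants K (p ^ M₀ * p ^ M₀)) (hPT' : inv.SumInvLocalizationEqZero)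
    (hinv : ∀ v : HeightOneSpectrum (𝓞 K), Injective (inv (Sum.inr v)))
    (hH3 : ∀ x : galoisCohomology (mu K (p ^ M₀ * p ^ M₀)) 3,
      (∀ v : Place K, galoisCohomology.localization (mu K (p ^ M₀ * p ^ M₀)) v 3 x = 0) → x = 0)
    (hB : Literature.GroupTheory.FiniteAbelian.IsLevelPairing (p ^ M₀)
      (ctLevelPairing (W.baseChange K) (p ^ M₀) e hμ hadd₁ hadd₂ hgal inv halt hPT' hH3
        (localTerm_finite_support (W := W.baseChange K) (m := p ^ M₀) (e := e) (hμ := hμ)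
          (hadd₁ := hadd₁) (hadd₂ := hadd₂) (hgal := hgal) halt inv)))
    (hPτ : ∀ z ∈ selmerGroup (W.baseChange K) ((p ^ M₀ * p ^ M₀ : ℕ) : ℤ),
      ∀ t ∈ selmerGroup (W.baseChange K) ((p ^ M₀ * p ^ M₀ : ℕ) : ℤ),
      ctGeneralFun (W.baseChange K) (p ^ M₀) e hμ hadd₁ hadd₂ hgal inv
          (torsionH1ToH1 (W.baseChange K) _ (conjAct W c _ z))
          (torsionH1ToH1 (W.baseChange K) _ (conjAct W c _ t)) =
        ctGeneralFun (W.baseChange K) (p ^ M₀) e hμ hadd₁ hadd₂ hgal inv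
          (torsionH1ToH1 (W.baseChange K) _ z) (torsionH1ToH1 (W.baseChange K) _ t)) :
    Finite (AddCommGroup.primaryComponent (W.baseChange K).sha p) ∧
    (∀ c ∈ AddCommGroup.primaryComponent (W.baseChange K).sha p, p ^ M₀ • c = 0) ∧
    Nat.card (AddCommGroup.primaryComponent (W.baseChange K).sha p) ≤ p ^ (2 * M₀) ∧
    padicValNat p (Nat.card (AddCommGroup.primaryComponent (W.baseChange K).sha p)) ≤ 2 * M₀ := by
  refine card_sha_primary_le_at_of_leavesM₂_of_localDuality_shift W hK hN k hnt hp hp2 hρ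
    Literature.NumberTheory.Automorphic.chebotarev_artinRep_holds (W.exists_weilPairing_holds p) hM₀
    hc hcc hx₀ hmax ?_ e hμ hadd₁ hadd₂ hgal halt hnondeg inv hPT' hinv hH3 hB hPτ
  intro M hM hdiv c₁ hc₁
  obtain ⟨ε, τ, hτ, A, hA, Pt, hPt, hε, h53, hAτ, hPt1, hm'⟩ := hpoints hM hdiv c₁ hc₁
  obtain ⟨cl, hc1, hcl⟩ := exists_leafA_of_points_shift (N := N₀) k hdiv c₁ hτ ε A hA hAτ Pt hPt hPt1
    (fun m hm'' hk ↦ (hm' m hm'' hk).1) (fun m hm'' hk ↦ (hm' m hm'' hk).2.1)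
    (fun m hm'' hk ↦ (hm' m hm'' hk).2.2)
  have hMk : M ≤ M + k := Nat.le_add_right M k
  refine ⟨ε, cl, hε, h53, hc1, hcl, fun ℓ hℓ ↦ ?_, fun ℓ ℓ' hℓ hℓ' ↦ ?_⟩
  · exact hdual_of_kolyvaginReciprocityFinset_of_conductorNorm W hN hK hp hp2 hM hc₁
      (fun hℓ hℓM ↦ hRT hM hℓ hℓM) ℓ ⟨hℓ.1, frobEqFrobInfty_pow_of_le W K hMk hℓ.2⟩
  · exact hdual₂_of_kolyvaginReciprocityFinset_of_conductorNorm W hN hK hp hp2 hM hc₁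
      (fun hℓ hℓM ↦ hRT hM hℓ hℓM) ℓ ℓ' ⟨hℓ.1, frobEqFrobInfty_pow_of_le W K hMk hℓ.2⟩
      ⟨hℓ'.1, frobEqFrobInfty_pow_of_le W K hMk hℓ'.2⟩

end Summit.BirchSwinnertonDyer.BirchSwinnertonDyer.Theorems.ShimuraKolyvaginOrder
end
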